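import Summits.BirchSwinnertonDyer.BirchSwinnertonDyer.Theorems.BiquadraticEisensteinDescentHeegnerTwistCouplingInSupplySymbolicMonskyOddDesignNegTwoTrivial
import Summits.BirchSwinnertonDyer.BirchSwinnertonDyer.Theorems.BiquadraticEisensteinDescentHeegnerTwistCouplingInSupplySymbolicMonskyMuOneExists
import HarnessLib

set_option linter.dupNamespace false -- `Summit.BirchSwinnertonDyer.BirchSwinnertonDyer.Theorems.…` (summit = sub)
set_option autoImplicit false

/-!
# Crux `HeegnerTwistCouplingInSupply` (stmt-BirchSwinnertonDyer-21381) — the ODD family universality theorem through the door: the crux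
# conclusion at `(E_{n₀}, P₀)` for EVERY odd base `n₀ ≡ 7 (mod 8)` with all `P_b ≡ ±1 (mod 8)` (every odd μ)

Route `BiquadraticEisensteinDescent` (cell `pub/bsd-wall`, width seat `bsd-wall-cm-bed-w3` g24; `--supports` 21381, helper). Combines the
hypothesis-free odd design theorem `exists_patternFree_design_of_negTwo_false_odd` (family `(2/P_b) = +1`, all odd μ) with the realisation door
`RealisesK.cruxOn_odd_of_BT_of_forall` (w3 g21), exactly as THEOREM B's door `exists_recipe_cruxOn_odd_muOne` (p745248):
★★★ `exists_recipe_cruxOn_odd_of_negTwo_false` — for EVERY odd base `P₀ … P_k` with all `P_b ≡ ±1 (mod 8)` and an odd number `≡ 7 (mod 8)` there is ONE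
list `aux` of `τ₀ + 1` auxiliary cells with `heegnerK` such that ANY realising primes in the size window `√(∏q)·log(∏q) < π·P₀` give an imaginary
quadratic `K`, `|d_K| > 4`, Heegner for `N(E_{n₀})`, `L(E_{n₀}^{(d_K)}, 1) ≠ 0`, `P₀ ∤ h(K)` — the CONCLUSION of `HeegnerTwistCouplingInSupply` at
`(E_{n₀}, P₀)` modulo Burungale–Tian. New beyond THEOREM B exactly on the bases with μ ≥ 3.

HONEST FRAMING: RUNG-LEVEL corner layer; instances still need located primes and the print input; the crux as stated (C⁺), its registered stubs and
BSD are NOT touched; nothing is closed. THEOREMS ONLY.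
References: [HeathBrown1994] appendix (Monsky), typescript pp. 39–41; [BurungaleTian2026, Thm. 1.1]; [Oesterle1988Gauss, II §3 p. 57 (27)].
-/

namespace Summit.BirchSwinnertonDyer.BirchSwinnertonDyer.Theorems.SymbolicMonsky

section OddFamilyDoor

open Matrix Module Literature.NumberTheory.EllipticCurves Literature.NumberTheory.EllipticCurves.HeathBrown1994
  Literature.NumberTheory.EllipticCurves.HeathBrown1994.Families
open Literature.NumberTheory.EllipticCurves.Rank1Residual

variable {k : ℕ} (base : SymbData (k + 1))

/-- ★★★ **Odd family `(2/P_b) = +1` through the door** (see the module docstring). [cite: HeathBrown1994SelmerCongruentII, Appendix (Monsky),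
typescript pp. 39–41] [cite: BurungaleTian2026, Thm. 1.1] [cite: Oesterle1988Gauss, II §3 Proposition p. 57 (27)] -/
theorem exists_recipe_cruxOn_odd_of_negTwo_false (hBT : burungaleTian_analyticRank_eq_zero_of_selmerCorank_eq_zero_of_hasCM)
    (hd : ∀ b, negTwo (base.cls b) = false) (hμ : (∑ b, bz (negNegOne (base.cls b))) = 1) :
    ∃ aux : List AuxCell, aux.length = (finrank (ZMod 2) ↥base.virtualKernel + 1) / 2 + 1 ∧ heegnerK base aux = true ∧
      ∀ (P : Fin (k + 1) → ℕ) (q : Fin aux.length → ℕ), RealisesK base aux P q →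
        ∀ (n : ℕ) [(congruentNumberCurve n).IsElliptic], (∏ b, P b) = n →
          Real.sqrt ((∏ j, q j : ℕ) : ℝ) * Real.log ((∏ j, q j : ℕ) : ℝ) < Real.pi * P 0 →
          ∃ (K : Type) (_ : Field K) (_ : NumberField K),
            IsImaginaryQuadratic K ∧ 4 < (NumberField.discr K).natAbs ∧
            SatisfiesHeegnerHypothesis ((congruentNumberCurve n).conductorNorm ℤ) K ∧
            ((congruentNumberCurve n).quadraticTwist (NumberField.discr K : ℚ)).entireLFunction 1 ≠ 0 ∧
            ¬ P 0 ∣ NumberField.classNumber K := by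
  obtain ⟨c₁, rest, hlen, hH, hdet⟩ := exists_patternFree_design_of_negTwo_false_odd base hd hμ
  refine ⟨c₁ :: rest, by simp [hlen], hH, ?_⟩
  intro P q hR n _ hn hsize
  exact hR.cruxOn_odd_of_BT_of_forall hBT hH hdet hn hsize

end OddFamilyDoor

end Summit.BirchSwinnertonDyer.BirchSwinnertonDyer.Theorems.SymbolicMonsky
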